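import Summits.CriticalPhenomena.SAWScalingLimit.Theorems.SAWMassiveIsingTiltLatticeUniversalityRotatedRelay
import Summits.CriticalPhenomena.SAWScalingLimit.Theorems.SAWDevelopingMapHexTransferGMHexDictionary

/-!
# Crux `LatticeUniversality` (stmt-CriticalPhenomena-0807), line `registered`: the rotated AND half-shifted
# Yang–Baxter relay composed (glue of skeleton v3, `Cruxes/LatticeUniversality/Lines/birth.lean`)

Line lead prover-line-stmt-CriticalPhenomena-0807-c1-0 (2026-08-17), continuing
`…LatticeUniversalityRotatedRelay.lean` (p143793, skeleton v2). The crux is the asymptotic equality, on ALL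
bounded continuous test functions and with no limit assumed, of the critical chordal SAW laws of `δℤ²`
(`SAW.law`) and of the honeycomb `δ·hexCenter` (`SAW.hexSAWLaw`), every Dobrushin domain, every pair of
endpoint approximations.

Why v3. The Glazman–Manolescu `π/3` honeycomb at mesh `δ` is `S_δ(δ·hexCenter)` with `S_δ z = i z − iδ/2`
(`Cruxes.HexTransfer.YbRelay.gmSimilarity`): a quarter turn (v2 moved it to the `δℤ²` end, where it is an
exact lattice symmetry) AND a half-period shift `iδ/2` (0 is a hexagon centre for `hexCenter`, an edge
midpoint for GM). v3 runs the `π/3` GM law in the MOVING domain `S_δ(D) = σD − iδ/2`, `σ z = i z`: the landed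
exact `π/3` dictionary (`Cruxes.HexTransfer.YbRelay.stub_gmHexDictionary`, crux 14221) then identifies it
with the critical hexagonal law of a face domain `⊆ S_δ⁻¹(S_δ D) = D` on the SAME lattice `δ·hexCenter`,
so the hexagonal-end residue is hex-only MICRO-ROBUSTNESS (inner-cell vs vertex discretisation of one fixed
domain, endpoint relocation; bounded-Lipschitz merging, `∃`-form), while the sub-mesh shift is paid at the
transport step, whose engine (route SAWTrackTransport's robust limits `RL`) carries `‖u δ‖ ≤ δ` moving
domains by design.

This file proves, sorry-free (statements written out; no workfile-local definition in any header):
* `hexThirdShiftBL_of_microRobust` — micro-robustness ⇒ the convention bridge "GM `π/3` law in `S_δ(D)` vs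
  the `S_δ`-image of the hexagonal law of `D` merge on bounded `1`-Lipschitz test functions" (dictionary +
  `≤ 2δ` polyline discrepancy + `≤ δ/2` twice for `S_δ ↔ σ`, all free for Lipschitz `f`);
* `thirdToSquareRobustBL_of_trackTransport` — `YBLimitExists` (16995) ∧ `AngleUniversality` (16963) ⇒ the
  transport stub with moving domains on the `π/3` side;
* `latticeUniversality_of_shiftedRelay` — the composition: `HexTight` (5423) → micro-robustness →
  robust transport → `YBtoUniform` (16966) → merging upgrade → `LatticeUniversality`.
Sources: A. Glazman, I. Manolescu, arXiv:1708.00395 §1 p. 3, Fig. 2, §4; H. Duminil-Copin et al.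
(DKKMO), arXiv:2012.11672 Thm 2.1; A. D'Aristotile, P. Diaconis, D. Freedman, *On merging of probabilities*
(1988); V. Beffara (2008) §2.2.
-/

noncomputable section

namespace Summit.CriticalPhenomena.SAWScalingLimit.Cruxes.LatticeUniversality.Birth

open MeasureTheory Filter Topology Set
open scoped NNReal ENNReal BoundedContinuousFunction
open Complex (I I_ne_zero)
open Literature.Probability.RandomPlanarGeometry
open Literature.Probability.RandomPlanarGeometry.SAW
open Literature.Probability.RandomPlanarGeometry.SAW.YangBaxter
open Literature.Probability.LatticeModels (Site HexVertex hexGraph hexCenter)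
open Summit.CriticalPhenomena.SAWScalingLimit.Theses
open Summit.CriticalPhenomena.SAWScalingLimit.Cruxes.HexTransfer.YbRelay (third IsBdryEdge bdryVertex
  faceDomain gmSimilarity stub_gmHexDictionary)

/-! ### The half-period shift: admissible for `RL`, free for Lipschitz test functions -/

/-- The half-period shift `u δ = −iδ/2` is an admissible family of sub-mesh translates: `‖−iδ/2‖ ≤ δ` for
`δ > 0`. [folklore] -/
theorem eventually_norm_halfShift_le :
    ∀ᶠ δ in 𝓝[>] (0 : ℝ), ‖(fun δ : ℝ => -(I * (δ : ℂ) / 2)) δ‖ ≤ δ := by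
  filter_upwards [self_mem_nhdsWithin] with δ hδ
  have hδ' : (0 : ℝ) < δ := hδ
  simp only [norm_neg, norm_div, norm_mul, Complex.norm_I, one_mul, Complex.norm_real, Real.norm_eq_abs,
    abs_of_pos hδ', Complex.norm_ofNat]
  linarith

/-- The half-shifted quarter turn `S_δ z = i z − iδ/2` moves a curve class away from its quarter turn
`σ z = i z` by at most `|δ|/2`. [folklore] -/
theorem dist_map_gmSimilarity_map_le (δ : ℝ) (c : CurveClass ℂ) :
    dist (CurveClass.map (gmSimilarity δ : C(ℂ, ℂ)) c)
      (CurveClass.map (similarity I I_ne_zero 0 : C(ℂ, ℂ)) c) ≤ |δ| / 2 := by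
  obtain ⟨γ, rfl⟩ := CurveClass.surjective_mk c
  rw [CurveClass.map_mk, CurveClass.map_mk]
  change dist (SeparationQuotient.mk _) (SeparationQuotient.mk _) ≤ _
  rw [SeparationQuotient.dist_mk]
  refine (Curve.dist_le_dist_toContinuousMap _ _).trans ((ContinuousMap.dist_le (by positivity)).2 fun t => ?_)
  change dist (gmSimilarity δ (γ t)) (similarity I I_ne_zero 0 (γ t)) ≤ |δ| / 2
  rw [Cruxes.HexTransfer.YbRelay.gmSimilarity_apply, similarity_apply, add_zero, dist_eq_norm,
    sub_sub_cancel_left, norm_neg, norm_div, norm_mul, Complex.norm_I, one_mul, Complex.norm_real,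
    Real.norm_eq_abs, Complex.norm_ofNat]

/-- **Small displacements are free for Lipschitz test functions**: if two random curve classes `u`, `v` on
one sample space are pointwise `C`-close and `f` is `1`-Lipschitz, their `f`-integrals under a law of
mass `≤ 1` differ by at most `C`. [folklore] -/
theorem abs_integral_sub_integral_le_of_dist_le {α : Type*} [MeasurableSpace α] (μ : Measure α)
    (hμ : μ Set.univ ≤ 1) (f : BoundedContinuousFunction (CurveClass ℂ) ℝ) (hf : LipschitzWith 1 f)
    {u v : α → CurveClass ℂ} {C : ℝ} (hC : 0 ≤ C) (huv : ∀ x, dist (u x) (v x) ≤ C)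
    (hu : AEStronglyMeasurable (fun x => f (u x)) μ) (hv : AEStronglyMeasurable (fun x => f (v x)) μ) :
    |(∫ x, f (u x) ∂μ) - ∫ x, f (v x) ∂μ| ≤ C := by
  haveI : IsFiniteMeasure μ := ⟨hμ.trans_lt ENNReal.one_lt_top⟩
  have hi : ∀ {w : α → CurveClass ℂ}, AEStronglyMeasurable (fun x => f (w x)) μ →
      Integrable (fun x => f (w x)) μ :=
    fun h => Integrable.of_bound h ‖f‖ (ae_of_all _ fun x => f.norm_coe_le_norm _)
  rw [← integral_sub (hi hu) (hi hv), ← Real.norm_eq_abs]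
  have hbound : ∀ x, ‖f (u x) - f (v x)‖ ≤ C := fun x => by
    rw [← dist_eq_norm]
    refine (hf.dist_le_mul _ _).trans ?_
    rw [NNReal.coe_one, one_mul]
    exact huv x
  refine (norm_integral_le_of_norm_le_const (ae_of_all _ hbound)).trans ?_
  have hreal : μ.real Set.univ ≤ 1 := by
    rw [Measure.real, ← ENNReal.toReal_one]
    exact ENNReal.toReal_mono ENNReal.one_ne_top hμ
  nlinarith [measureReal_nonneg (μ := μ) (s := Set.univ)]

/-- **The `iδ/2` displacement is free for Lipschitz test functions**: for a `1`-Lipschitz `f`, the law `μ`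
of hexagonal SAWs (mass `≤ 1`) and `δ ≥ 0`, `|∫ f (S_δ ∘ curve) dμ − ∫ f (σ ∘ curve) dμ| ≤ δ/2`. [folklore] -/
theorem abs_integral_shift_sub_le {Ω : Set ℂ} {δ : ℝ} (hδ : 0 ≤ δ) {a b : HexVertex}
    (f : BoundedContinuousFunction (CurveClass ℂ) ℝ) (hf : LipschitzWith 1 f) :
    |(∫ γ, f (CurveClass.map (gmSimilarity δ : C(ℂ, ℂ)) γ.curve) ∂(SAW.hexSAWLaw Ω δ a b)) -
        ∫ γ, f (CurveClass.map (similarity I I_ne_zero 0 : C(ℂ, ℂ)) γ.curve) ∂(SAW.hexSAWLaw Ω δ a b)| ≤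
      δ / 2 := by
  have h := abs_integral_sub_integral_le_of_dist_le (SAW.hexSAWLaw Ω δ a b) (hexSAWLaw_univ_le_one _ _ _ _)
    f hf (by positivity : (0 : ℝ) ≤ |δ| / 2) (fun γ => dist_map_gmSimilarity_map_le δ γ.curve)
    (SAW.EmbDomainSAW.measurable_of_top _).aestronglyMeasurable
    (SAW.EmbDomainSAW.measurable_of_top _).aestronglyMeasurable
  rwa [abs_of_nonneg hδ] at h

/-! ### The exact `π/3` dictionary consumes everything but micro-robustness -/

/-- **The convention bridge from micro-robustness.** In the moving domain `S_δ(D)` the critical GM `π/3` law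
between the chosen boundary mid-edges IS the push-forward of the critical hexagonal law of the face domain
`⊆ D` (landed `stub_gmHexDictionary`, crux 14221), along a map moving drawn curves by `≤ 2δ` from their
`S_δ`-images; replacing `S_δ` by `σ` costs `≤ δ/2` twice; what is left is exactly micro-robustness tested on
`f ∘ σ`. Hypothesis = registered stub `stub_hexMicroRobust` of skeleton v3, written out; conclusion = the
skeleton's `HexThirdShiftBL`, written out. [cite: GlazmanManolescu2019, §1 p. 3 and Fig. 2] -/
theorem hexThirdShiftBL_of_microRobust : (∀ (D : DobrushinDomain) (a b : ℝ → HexVertex), SAW.IsEmbEndpointApprox hexGraph hexCenter D a b → ∃ a' b' : ℝ → MidEdge, (∀ᶠ δ in 𝓝[>] (0 : ℝ), a' δ ≠ b' δ ∧ IsBdryEdge (meshFaces third (((D.map (similarity I I_ne_zero 0)).map (similarity 1 one_ne_zero (-(I * (δ : ℂ) / 2)))).carrier) δ) (a' δ) ∧ IsBdryEdge (meshFaces third (((D.map (similarity I I_ne_zero 0)).map (similarity 1 one_ne_zero (-(I * (δ : ℂ) / 2)))).carrier) δ) (b' δ) ∧ Nonempty (YangBaxterSAW third (((D.map (similarity I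 I_ne_zero 0)).map (similarity 1 one_ne_zero (-(I * (δ : ℂ) / 2)))).carrier) δ (a' δ) (b' δ))) ∧ Tendsto (fun δ : ℝ => (δ : ℂ) * planeMidpoint third (a' δ)) (𝓝[>] (0 : ℝ)) (𝓝 ((D.map (similarity I I_ne_zero 0)).pt 0)) ∧ Tendsto (fun δ : ℝ => (δ : ℂ) * planeMidpoint third (b' δ)) (𝓝[>] (0 : ℝ)) (𝓝 ((D.map (similarity I I_ne_zero 0)).pt 1)) ∧ ∀ f : BoundedContinuousFunction (CurveClass ℂ) ℝ, LipschitzWith 1 f → Tendsto (fun δ : ℝ => (∫ γ, f γ.curve ∂(SAW.hexSAWLaw (faceDomain (((D.map (similarity I I_ne_zero 0)).map (similarity 1 one_ne_zero (-(I * (δ : ℂ) / 2)))).carrier) δ (a' δ)) δ (bdryVertex (meshFaces third (((D.map (similarity I I_ne_zero 0)).map (similarity 1 one_ne_zero (-(I * (δ : ℂ) / 2)))).carrier) δ) (a' δ)) (bdryVertex (meshFaces third (((D.map (similarity I I_ne_zero 0)).map (similarity 1 one_ne_zero (-(I * (δ : ℂ) / 2)))).carrier) δ) (b' δ)))) - ∫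 γ, f γ.curve ∂(SAW.hexSAWLaw D.carrier δ (a δ) (b δ))) (𝓝[>] (0 : ℝ)) (𝓝 0)) → ∀ (D : DobrushinDomain) (a b : ℝ → HexVertex), SAW.IsEmbEndpointApprox hexGraph hexCenter D a b → ∃ a' b' : ℝ → MidEdge, (∀ᶠ δ : ℝ in 𝓝[>] (0 : ℝ), Nonempty (YangBaxterSAW third (((D.map (similarity I I_ne_zero 0)).map (similarity 1 one_ne_zero (-(I * (δ : ℂ) / 2)))).carrier) δ (a' δ) (b' δ))) ∧ Tendsto (fun δ : ℝ => (δ : ℂ) * planeMidpoint third (a' δ)) (𝓝[>] (0 : ℝ)) (𝓝 ((D.map (similarity I I_ne_zero 0)).pt 0)) ∧ Tendsto (fun δ : ℝ => (δ : ℂ) * planeMidpoint third (b' δ)) (𝓝[>] (0 : ℝ)) (𝓝 ((D.map (similarity I I_ne_zero 0)).pt 1)) ∧ ∀ f : BoundedContinuousFunction (CurveClass ℂ) ℝ, LipschitzWith 1 f → Tendsto (fun δ : ℝ => (∫ γ, f (γ.curve third δ) ∂(ybLaw third (((D.map (similarity I I_ne_zero 0)).map (similarity 1 one_ne_zero (-(I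 * (δ : ℂ) / 2)))).carrier) δ 1 (a' δ) (b' δ))) - ∫ γ, f (CurveClass.map (gmSimilarity δ : C(ℂ, ℂ)) γ.curve) ∂(SAW.hexSAWLaw D.carrier δ (a δ) (b δ))) (𝓝[>] (0 : ℝ)) (𝓝 0) := by
  intro hK D a b hab
  obtain ⟨a', b', hev, ha', hb', hM⟩ := hK D a b hab
  refine ⟨a', b', hev.mono fun δ h => h.2.2.2, ha', hb', fun f hf => ?_⟩
  -- micro-robustness tested on the `1`-Lipschitz function `f ∘ σ`
  have hσL : LipschitzWith 1 (CurveClass.map (similarity I I_ne_zero 0 : C(ℂ, ℂ))) := by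
    simpa using CurveClass.lipschitzWith_map (lipschitzWith_similarity I I_ne_zero 0)
  set fσ : BoundedContinuousFunction (CurveClass ℂ) ℝ :=
    f.compContinuous ⟨CurveClass.map (similarity I I_ne_zero 0 : C(ℂ, ℂ)), hσL.continuous⟩ with hfσ_def
  have hfσ : LipschitzWith 1 fσ := by
    simpa [hfσ_def] using hf.comp hσL
  have hC := hM fσ hfσ
  -- the remaining three brackets are `O(δ)`, eventually
  have hsmall : ∀ᶠ δ : ℝ in 𝓝[>] (0 : ℝ),
      |((∫ γ, f (γ.curve third δ)
            ∂(ybLaw third (((D.map (similarity I I_ne_zero 0)).map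
                (similarity 1 one_ne_zero (-(I * (δ : ℂ) / 2)))).carrier) δ 1 (a' δ) (b' δ))) -
          ∫ γ, f (CurveClass.map (gmSimilarity δ : C(ℂ, ℂ)) γ.curve)
            ∂(SAW.hexSAWLaw D.carrier δ (a δ) (b δ))) -
        ((∫ γ, fσ γ.curve ∂(SAW.hexSAWLaw
            (faceDomain (((D.map (similarity I I_ne_zero 0)).map
              (similarity 1 one_ne_zero (-(I * (δ : ℂ) / 2)))).carrier) δ (a' δ)) δ
            (bdryVertex (meshFaces third (((D.map (similarity I I_ne_zero 0)).map
              (similarity 1 one_ne_zero (-(I * (δ : ℂ) / 2)))).carrier) δ) (a' δ))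
            (bdryVertex (meshFaces third (((D.map (similarity I I_ne_zero 0)).map
              (similarity 1 one_ne_zero (-(I * (δ : ℂ) / 2)))).carrier) δ) (b' δ)))) -
          ∫ γ, fσ γ.curve ∂(SAW.hexSAWLaw D.carrier δ (a δ) (b δ)))| ≤ 3 * δ := by
    filter_upwards [hev, self_mem_nhdsWithin] with δ hδe hδ
    obtain ⟨hne, hba, hbb, hnon⟩ := hδe
    have hδ0 : (0 : ℝ) < δ := hδ
    obtain ⟨φ, hlaw, hdist⟩ := stub_gmHexDictionary _ δ hδ0 (a' δ) (b' δ) hne hba hbb hnon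
    -- (A) transport the GM integral along the dictionary and pay `2δ`
    have hA : |(∫ γ, f (γ.curve third δ)
          ∂(ybLaw third (((D.map (similarity I I_ne_zero 0)).map
              (similarity 1 one_ne_zero (-(I * (δ : ℂ) / 2)))).carrier) δ 1 (a' δ) (b' δ))) -
        ∫ γ, f (CurveClass.map (gmSimilarity δ : C(ℂ, ℂ)) γ.curve) ∂(SAW.hexSAWLaw
            (faceDomain (((D.map (similarity I I_ne_zero 0)).map
              (similarity 1 one_ne_zero (-(I * (δ : ℂ) / 2)))).carrier) δ (a' δ)) δ
            (bdryVertex (meshFaces third (((D.map (similarity I I_ne_zero 0)).map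
              (similarity 1 one_ne_zero (-(I * (δ : ℂ) / 2)))).carrier) δ) (a' δ))
            (bdryVertex (meshFaces third (((D.map (similarity I I_ne_zero 0)).map
              (similarity 1 one_ne_zero (-(I * (δ : ℂ) / 2)))).carrier) δ) (b' δ)))| ≤ 2 * δ := by
      rw [hlaw, integral_map (SAW.EmbDomainSAW.measurable_of_top φ).aemeasurable
        (YBWalk.measurable_of_top _).aestronglyMeasurable]
      exact abs_integral_sub_integral_le_of_dist_le _ (hexSAWLaw_univ_le_one _ _ _ _) f hf
        (by positivity) hdist (SAW.EmbDomainSAW.measurable_of_top _).aestronglyMeasurable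
        (SAW.EmbDomainSAW.measurable_of_top _).aestronglyMeasurable
    -- (B) `S_δ ↦ σ` on the face-domain side, (D) `σ ↦ S_δ` on the `D` side: `δ/2` each
    have hB := abs_integral_shift_sub_le hδ0.le (Ω := faceDomain (((D.map (similarity I I_ne_zero 0)).map
        (similarity 1 one_ne_zero (-(I * (δ : ℂ) / 2)))).carrier) δ (a' δ))
      (a := bdryVertex (meshFaces third (((D.map (similarity I I_ne_zero 0)).map
        (similarity 1 one_ne_zero (-(I * (δ : ℂ) / 2)))).carrier) δ) (a' δ))
      (b := bdryVertex (meshFaces third (((D.map (similarity I I_ne_zero 0)).map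
        (similarity 1 one_ne_zero (-(I * (δ : ℂ) / 2)))).carrier) δ) (b' δ)) f hf
    have hD := abs_integral_shift_sub_le hδ0.le (Ω := D.carrier) (a := a δ) (b := b δ) f hf
    -- `fσ ∘ curve = f ∘ σ ∘ curve`
    simp only [hfσ_def, BoundedContinuousFunction.compContinuous_apply, ContinuousMap.coe_mk]
    rw [abs_le] at hA hB hD ⊢
    constructor <;> linarith [hA.1, hA.2, hB.1, hB.2, hD.1, hD.2]
  -- conclude: the difference to the micro-robustness bracket is `O(δ)`, the bracket tends to `0`
  have h3δ : Tendsto (fun δ : ℝ => 3 * δ) (𝓝[>] (0 : ℝ)) (𝓝 0) := by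
    have h : Tendsto (fun δ : ℝ => 3 * δ) (𝓝 (0 : ℝ)) (𝓝 (3 * 0)) := tendsto_id.const_mul 3
    rw [mul_zero] at h
    exact tendsto_nhdsWithin_of_tendsto_nhds h
  have hdiff := squeeze_zero_norm' (hsmall.mono fun δ h => le_of_eq_of_le (Real.norm_eq_abs _) h) h3δ
  have h := hdiff.add hC
  rw [add_zero] at h
  exact h.congr fun δ => by ring

/-! ### Where the transport stub sits -/

/-- **The robust transport stub follows from route SAWTrackTransport's `YBLimitExists` (stmt-16995) and
`AngleUniversality` (stmt-16963).** Take the robust full square limit `P`; angle universality makes it the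
robust full limit at `π/3`; the robust limit at `π/3` sends the laws of the MOVING domains `D + u δ` to `P D`,
the robust limit at `π/2` specialised to `u ≡ 0` (`tendstoLaw_of_robustLimit`, p138469) sends the laws of `D`
along the landed compass approximation to `P D`; subtract. Conclusion = registered stub
`stub_thirdToSquareRobustBL` of skeleton v3, written out. [folklore] -/
theorem thirdToSquareRobustBL_of_trackTransport : SAWTrackTransport.YBLimitExists → SAWTrackTransport.AngleUniversality → ∀ (D : DobrushinDomain) (u : ℝ → ℂ) (a b : ℝ → MidEdge), (∀ᶠ δ in 𝓝[>] (0 : ℝ), ‖u δ‖ ≤ δ) → (∀ᶠ δ in 𝓝[>] (0 : ℝ), Nonempty (YangBaxterSAW (fun (_ : ℤ) => Real.pi / 3) ((D.map (similarity 1 one_ne_zero (u δ))).carrier) δ (a δ) (b δ))) → Tendsto (fun δ : ℝ => (δ : ℂ) * planeMidpoint (fun (_ : ℤ) => Real.pi / 3) (a δ)) (𝓝[>] (0 : ℝ)) (𝓝 (D.pt 0)) → Tendsto (fun δ : ℝ => (δ : ℂ) * planeMidpoint (fun (_ : ℤ) => Real.pi / 3) (b δ)) (𝓝[>] (0 : ℝ))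 (𝓝 (D.pt 1)) → ∃ a' b' : ℝ → MidEdge, IsYBEndpointApprox (fun (_ : ℤ) => Real.pi / 2) D a' b' ∧ ∀ f : BoundedContinuousFunction (CurveClass ℂ) ℝ, LipschitzWith 1 f → Tendsto (fun δ : ℝ => (∫ γ, f (γ.curve (fun (_ : ℤ) => Real.pi / 3) δ) ∂(ybLaw (fun (_ : ℤ) => Real.pi / 3) ((D.map (similarity 1 one_ne_zero (u δ))).carrier) δ 1 (a δ) (b δ))) - ∫ γ, f (γ.curve (fun (_ : ℤ) => Real.pi / 2) δ) ∂(ybLaw (fun (_ : ℤ) => Real.pi / 2) D.carrier δ 1 (a' δ) (b' δ))) (𝓝[>] (0 : ℝ)) (𝓝 0) := by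
  intro hL hAU D u a b hu hne ha hb
  obtain ⟨a', b', hab'⟩ := Cruxes.HexTransfer.Sketch.stub_compassEndpoints D
  refine ⟨a', b', hab', fun f _ => ?_⟩
  obtain ⟨-, P, hPch, hconv2⟩ := hL
  have hmem : Real.pi / 3 ∈ Set.Icc (Real.pi / 3) (2 * Real.pi / 3) := ⟨le_rfl, by linarith [Real.pi_pos]⟩
  have hconv3 := hAU (Real.pi / 3) hmem P hPch hconv2
  have h3 := hconv3 D u a b hu hne ha hb f
  have h2 := Cruxes.HexTransfer.YbRelay.tendstoLaw_of_robustLimit (Real.pi / 2) P hconv2 D a' b' hab' f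
  have hsub := h3.sub h2
  rwa [sub_self] at hsub

/-! ### The composition -/

/-- **The rotated and half-shifted Yang–Baxter relay, composed** (crux stmt-CriticalPhenomena-0807 from the
registered stub statements of skeleton v3, written out): tightness of the hexagonal end (= `HexTight`,
stmt-5423) → micro-robustness of the hexagonal law → robust transport `π/3 → π/2` → the toll `YBtoUniform`
(stmt-16966) → the merging upgrade → `LatticeUniversality`. Fix `D`, `(a, b)`, `(a', b')`, `f`; `σ z = i z`,
`S_δ = σ − iδ/2`, `g = f ∘ σ⁻¹`. Square end: `∫ f∘curve dP^{ℤ²}(D) = ∫ g∘curve dP^{ℤ²}(σD; σa, σb)` exactly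
(`integral_quarterTurn`); toll in `σD` on `g`. Hexagonal end: micro-robustness + dictionary give `(a₃, b₃)` on
the moving domains `S_δ(D)` (`hexThirdShiftBL_of_microRobust`), the transport stub with `u δ = −iδ/2` gives
`(a₂, b₂)` on `σD`; on Lipschitz functions `Q^{π/2}(σD) − σ_*P^{Hex}(D)` splits into three vanishing
brackets (the last `≤ δ/2`, `abs_integral_shift_sub_le`); the merging upgrade with the tightness of
`σ_* P^{Hex}(D)` lifts this to `g`; `g ∘ σ = f`. [folklore] -/
theorem latticeUniversality_of_shiftedRelay : (∀ (D : DobrushinDomain) (a b : ℝ → HexVertex), SAW.IsEmbEndpointApprox hexGraph hexCenter D a b → IsTightAlongMesh (fun δ (γ : SAW.HexDomainSAW D.carrier δ (a δ) (b δ)) => γ.curve) (fun δ => SAW.hexSAWLaw D.carrier δ (a δ) (b δ))) → (∀ (D : DobrushinDomain) (a b : ℝ → HexVertex), SAW.IsEmbEndpointApprox hexGraph hexCenter D a b → ∃ a' b' : ℝ → MidEdge, (∀ᶠ δ in 𝓝[>] (0 : ℝ), a' δ ≠ b' δ ∧ IsBdryEdge (meshFaces third (((D.map (similarity I I_ne_zero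 0)).map (similarity 1 one_ne_zero (-(I * (δ : ℂ) / 2)))).carrier) δ) (a' δ) ∧ IsBdryEdge (meshFaces third (((D.map (similarity I I_ne_zero 0)).map (similarity 1 one_ne_zero (-(I * (δ : ℂ) / 2)))).carrier) δ) (b' δ) ∧ Nonempty (YangBaxterSAW third (((D.map (similarity I I_ne_zero 0)).map (similarity 1 one_ne_zero (-(I * (δ : ℂ) / 2)))).carrier) δ (a' δ) (b' δ))) ∧ Tendsto (fun δ : ℝ => (δ : ℂ) * planeMidpoint third (a' δ)) (𝓝[>] (0 : ℝ)) (𝓝 ((D.map (similarity I I_ne_zero 0)).pt 0)) ∧ Tendsto (fun δ : ℝ => (δ : ℂ) * planeMidpoint third (b' δ)) (𝓝[>] (0 : ℝ)) (𝓝 ((D.map (similarity I I_ne_zero 0)).pt 1)) ∧ ∀ f : BoundedContinuousFunction (CurveClass ℂ) ℝ, LipschitzWith 1 f → Tendsto (fun δ : ℝ => (∫ γ, f γ.curve ∂(SAW.hexSAWLaw (faceDomain (((D.map (similarity I I_ne_zero 0)).map (similarity 1 one_ne_zero (-(I * (δ : ℂ) / 2)))).carrier) δ (a' δ)) δ (bdryVertex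 (meshFaces third (((D.map (similarity I I_ne_zero 0)).map (similarity 1 one_ne_zero (-(I * (δ : ℂ) / 2)))).carrier) δ) (a' δ)) (bdryVertex (meshFaces third (((D.map (similarity I I_ne_zero 0)).map (similarity 1 one_ne_zero (-(I * (δ : ℂ) / 2)))).carrier) δ) (b' δ)))) - ∫ γ, f γ.curve ∂(SAW.hexSAWLaw D.carrier δ (a δ) (b δ))) (𝓝[>] (0 : ℝ)) (𝓝 0)) → (∀ (D : DobrushinDomain) (u : ℝ → ℂ) (a b : ℝ → MidEdge), (∀ᶠ δ in 𝓝[>] (0 : ℝ), ‖u δ‖ ≤ δ) → (∀ᶠ δ in 𝓝[>] (0 : ℝ), Nonempty (YangBaxterSAW (fun (_ : ℤ) => Real.pi / 3) ((D.map (similarity 1 one_ne_zero (u δ))).carrier) δ (a δ) (b δ))) → Tendsto (fun δ : ℝ => (δ : ℂ) * planeMidpoint (fun (_ : ℤ) => Real.pi / 3) (a δ)) (𝓝[>] (0 : ℝ)) (𝓝 (D.pt 0)) → Tendsto (fun δ : ℝ => (δ : ℂ) * planeMidpoint (fun (_ : ℤ) => Real.pi / 3) (b δ)) (𝓝[>]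 (0 : ℝ)) (𝓝 (D.pt 1)) → ∃ a' b' : ℝ → MidEdge, IsYBEndpointApprox (fun (_ : ℤ) => Real.pi / 2) D a' b' ∧ ∀ f : BoundedContinuousFunction (CurveClass ℂ) ℝ, LipschitzWith 1 f → Tendsto (fun δ : ℝ => (∫ γ, f (γ.curve (fun (_ : ℤ) => Real.pi / 3) δ) ∂(ybLaw (fun (_ : ℤ) => Real.pi / 3) ((D.map (similarity 1 one_ne_zero (u δ))).carrier) δ 1 (a δ) (b δ))) - ∫ γ, f (γ.curve (fun (_ : ℤ) => Real.pi / 2) δ) ∂(ybLaw (fun (_ : ℤ) => Real.pi / 2) D.carrier δ 1 (a' δ) (b' δ))) (𝓝[>] (0 : ℝ)) (𝓝 0)) → SAWTrackTransport.YBtoUniform → (∀ (Ω₁ Ω₂ : ℝ → Type) [∀ δ, MeasurableSpace (Ω₁ δ)] [∀ δ, MeasurableSpace (Ω₂ δ)] (X : ∀ δ, Ω₁ δ → CurveClass ℂ) (Y : ∀ δ, Ω₂ δ → CurveClass ℂ) (P : ∀ δ, Measure (Ω₁ δ)) (Q : ∀ δ, Measure (Ω₂ δ)), (∀ δ, Measurable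 (X δ)) → (∀ δ, Measurable (Y δ)) → (∀ δ, P δ Set.univ ≤ 1) → (∀ δ, Q δ Set.univ ≤ 1) → IsTightAlongMesh Y Q → (∀ f : BoundedContinuousFunction (CurveClass ℂ) ℝ, LipschitzWith 1 f → Tendsto (fun δ : ℝ => (∫ ω, f (X δ ω) ∂(P δ)) - ∫ ω, f (Y δ ω) ∂(Q δ)) (𝓝[>] (0 : ℝ)) (𝓝 0)) → ∀ f : BoundedContinuousFunction (CurveClass ℂ) ℝ, Tendsto (fun δ : ℝ => (∫ ω, f (X δ ω) ∂(P δ)) - ∫ ω, f (Y δ ω) ∂(Q δ)) (𝓝[>] (0 : ℝ)) (𝓝 0)) → SAWMassiveIsingTilt.LatticeUniversality := by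
  intro hT h1 h2 h3 hU D a b a' b' hab hab' f
  -- the rotated `δℤ²` approximation of `σD`; the relay's approximations on `S_δ(D)` and on `σD`
  have habσ := Cruxes.HexTransfer.PinTheShear.stub_quarterTurnCovariance.2 D a b hab
  obtain ⟨a₃, b₃, hne₃, ha₃, hb₃, hH⟩ := hexThirdShiftBL_of_microRobust h1 D a' b' hab'
  obtain ⟨a₂, b₂, hab₂, hA⟩ := h2 (D.map (similarity I I_ne_zero 0)) (fun δ : ℝ => -(I * (δ : ℂ) / 2))
    a₃ b₃ eventually_norm_halfShift_le hne₃ ha₃ hb₃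
  -- the transported test function `g = f ∘ σ⁻¹`, with `g (σ c) = f c`
  set g : BoundedContinuousFunction (CurveClass ℂ) ℝ := f.compContinuous
    ⟨CurveClass.map (similarity (-I) (neg_ne_zero.2 I_ne_zero) 0 : C(ℂ, ℂ)),
      (CurveClass.lipschitzWith_map
        (lipschitzWith_similarity (-I) (neg_ne_zero.2 I_ne_zero) 0)).continuous⟩ with hg_def
  have hg : ∀ c, g (CurveClass.map (similarity I I_ne_zero 0 : C(ℂ, ℂ)) c) = f c := fun c => by
    simp only [hg_def, BoundedContinuousFunction.compContinuous_apply, ContinuousMap.coe_mk, map_negI_map_I]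
  -- bracket 1: the toll in `σD` on `g`
  have hZ := h3 (D.map (similarity I I_ne_zero 0)) (fun δ => ![-(a δ 1), a δ 0])
    (fun δ => ![-(b δ 1), b δ 0]) a₂ b₂ habσ hab₂ g
  -- brackets 2 + 3 + the free `iδ/2` displacement: bounded-Lipschitz merging `Q^{π/2}(σD) ↔ σ_* P^{Hex}(D)`
  have hBL : ∀ φ : BoundedContinuousFunction (CurveClass ℂ) ℝ, LipschitzWith 1 φ →
      Tendsto (fun δ : ℝ =>
          (∫ γ, φ (γ.curve (fun (_ : ℤ) => Real.pi / 2) δ)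
              ∂(ybLaw (fun (_ : ℤ) => Real.pi / 2) (D.map (similarity I I_ne_zero 0)).carrier δ 1
                  (a₂ δ) (b₂ δ))) -
            ∫ γ, φ (CurveClass.map (similarity I I_ne_zero 0 : C(ℂ, ℂ)) γ.curve)
              ∂(SAW.hexSAWLaw D.carrier δ (a' δ) (b' δ)))
        (𝓝[>] (0 : ℝ)) (𝓝 0) := by
    intro φ hφ
    -- the displacement bracket, squeezed by `δ/2`
    have hS : Tendsto (fun δ : ℝ =>
        (∫ γ, φ (CurveClass.map (gmSimilarity δ : C(ℂ, ℂ)) γ.curve)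
            ∂(SAW.hexSAWLaw D.carrier δ (a' δ) (b' δ))) -
          ∫ γ, φ (CurveClass.map (similarity I I_ne_zero 0 : C(ℂ, ℂ)) γ.curve)
            ∂(SAW.hexSAWLaw D.carrier δ (a' δ) (b' δ)))
        (𝓝[>] (0 : ℝ)) (𝓝 0) := by
      have h0 : Tendsto (fun δ : ℝ => δ / 2) (𝓝[>] (0 : ℝ)) (𝓝 0) := by
        have h : Tendsto (fun δ : ℝ => δ / 2) (𝓝 (0 : ℝ)) (𝓝 (0 / 2)) := tendsto_id.div_const 2
        rw [zero_div] at h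
        exact tendsto_nhdsWithin_of_tendsto_nhds h
      refine squeeze_zero_norm' ?_ h0
      filter_upwards [self_mem_nhdsWithin] with δ hδ
      exact le_of_eq_of_le (Real.norm_eq_abs _) (abs_integral_shift_sub_le (le_of_lt hδ) φ hφ)
    have h := ((hS.add (hH φ hφ)).sub (hA φ hφ))
    rw [add_zero, sub_zero] at h
    exact h.congr fun δ => by ring
  -- upgraded to all bounded continuous test functions by the tightness of the hexagonal end
  have hTY : IsTightAlongMesh
      (fun δ (γ : SAW.HexDomainSAW D.carrier δ (a' δ) (b' δ)) =>
        CurveClass.map (similarity I I_ne_zero 0 : C(ℂ, ℂ)) γ.curve)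
      (fun δ => SAW.hexSAWLaw D.carrier δ (a' δ) (b' δ)) :=
    isTightAlongMesh_comp (hT D a' b' hab')
      (CurveClass.lipschitzWith_map (lipschitzWith_similarity I I_ne_zero 0)).continuous
  have hXY := hU (fun δ => YangBaxterSAW (fun (_ : ℤ) => Real.pi / 2)
      (D.map (similarity I I_ne_zero 0)).carrier δ (a₂ δ) (b₂ δ))
    (fun δ => SAW.HexDomainSAW D.carrier δ (a' δ) (b' δ))
    (fun δ γ => γ.curve (fun (_ : ℤ) => Real.pi / 2) δ)
    (fun δ γ => CurveClass.map (similarity I I_ne_zero 0 : C(ℂ, ℂ)) γ.curve)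
    (fun δ => ybLaw (fun (_ : ℤ) => Real.pi / 2) (D.map (similarity I I_ne_zero 0)).carrier δ 1 (a₂ δ) (b₂ δ))
    (fun δ => SAW.hexSAWLaw D.carrier δ (a' δ) (b' δ))
    (fun δ => YBWalk.measurable_of_top _) (fun δ => SAW.EmbDomainSAW.measurable_of_top _)
    (fun δ => ybLaw_univ_le_one _ _ _ _ _ _) (fun δ => hexSAWLaw_univ_le_one _ _ _ _) hTY hBL g
  -- assemble
  have h := hZ.add hXY
  rw [add_zero] at h
  refine h.congr fun δ => ?_
  have hq : ∫ γ, g γ.curve ∂(SAW.law (D.map (similarity I I_ne_zero 0)).carrier δ ![-(a δ 1), a δ 0]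
      ![-(b δ 1), b δ 0]) = ∫ γ, g (CurveClass.map (similarity I I_ne_zero 0 : C(ℂ, ℂ)) γ.curve)
        ∂(SAW.law D.carrier δ (a δ) (b δ)) :=
    integral_quarterTurn D.carrier δ (a δ) (b δ) g
  simp only [hg] at hq ⊢
  linarith [hq]

end Summit.CriticalPhenomena.SAWScalingLimit.Cruxes.LatticeUniversality.Birth

end
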